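import Mathlib
import HarnessLib
import Literature.AlgebraicGeometry.DeterminantalHypersurfaces.LinearPencilForms

/-!
# ValiantsHypothesis / PermanentalCones — `HyperbolicVPShadow`, stub T

Route `PermanentalCones`, item `stmt-ValiantsHypothesis-8655` (crux `HyperbolicVPShadow`), line
`birth`, stub `stub_ternaryPencil_hyperbolicForm` (real-spectrum ternary pencils give hyperbolic
ternary forms, in the rendering consumed by the named fact
`Literature.AlgebraicGeometry.DeterminantalHypersurfaces.LewisParriloRamana2005_laxConjecture`).

Given three real `N × N` matrices `b₀, b₁, b₂` with `Σ eᵢ bᵢ = 1` such that every real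
combination `Σ wᵢ bᵢ` has only real (complex) eigenvalues, the form
`F := det (Σ Xᵢ bᵢ) ∈ ℝ[X₀, X₁, X₂]` is homogeneous of degree `N`, `F(e) = det 1 = 1`,
`F(v) = det (Σ vᵢ bᵢ)`, and for every `w` the univariate polynomial
`t ↦ F(w − t e) = det (Σ wᵢ bᵢ − t·1) = (−1)^N χ_M(t)` (`M := Σ wᵢ bᵢ`) has `N` real roots
counted with multiplicity: the characteristic polynomial of `M` splits over `ℂ`, and each of its
complex roots `a` satisfies `det (M − a·1) = 0`, hence is real by hypothesis, so `χ_M` splits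
over `ℝ` (`Polynomial.Splits.of_splits_map`).
-/

-- `<Problem> = <Summit>` for this single-conjunct summit (lakefile sets the same option tree-wide).
set_option linter.dupNamespace false

namespace Summit.ValiantsHypothesis.ValiantsHypothesis.Theorems

open Matrix Polynomial

/-- If every complex eigenvalue of the real matrix `M` (every `z ∈ ℂ` with `det (M − z·1) = 0`)
is real, then the characteristic polynomial of `M` splits over `ℝ`. [folklore] -/
theorem permanentalCones_charpoly_splits_of_realSpectrum {N : ℕ} (M : Matrix (Fin N) (Fin N) ℝ)
    (h : ∀ z : ℂ, (M.map (algebraMap ℝ ℂ) - z • (1 : Matrix (Fin N) (Fin N) ℂ)).det = 0 →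
      z.im = 0) :
    M.charpoly.Splits := by
  refine Polynomial.Splits.of_splits_map (algebraMap ℝ ℂ) (IsAlgClosed.splits _) fun a ha => ?_
  rw [← Matrix.charpoly_map, Polynomial.mem_roots (Matrix.charpoly_monic _).ne_zero,
    Polynomial.IsRoot.def, Matrix.eval_charpoly, Matrix.scalar_apply,
    ← Matrix.smul_one_eq_diagonal] at ha
  have hdet : (M.map (algebraMap ℝ ℂ) - a • (1 : Matrix (Fin N) (Fin N) ℂ)).det = 0 := by
    rw [← neg_sub, Matrix.det_neg, ha, mul_zero]
  have him : a.im = 0 := h a hdet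
  refine ⟨a.re, Complex.ext ?_ ?_⟩ <;> simp [him]

/-- **Stub T (real-spectrum ternary pencil ⇒ hyperbolic ternary form).** For real `N × N`
matrices `b₀, b₁, b₂` with `Σ eᵢ bᵢ = 1` all of whose real combinations have only real
eigenvalues, `F := det (Σ Xᵢ bᵢ)` is a ternary form of degree `N` with `F(e) = 1`,
`F(v) = det (Σ vᵢ bᵢ)`, and `t ↦ F(w − t e)` has `N` real roots for every `w ∈ ℝ³` — the
hypotheses of `LewisParriloRamana2005_laxConjecture` (after a change of coordinates taking `e` to
`(1,0,0)`). [folklore] -/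
theorem stub_ternaryPencil_hyperbolicForm :
    ∀ (N : ℕ) (b : Fin 3 → Matrix (Fin N) (Fin N) ℝ) (e : Fin 3 → ℝ),
      ∑ i, e i • b i = 1 →
      (∀ (w : Fin 3 → ℝ) (z : ℂ),
        ((∑ i, w i • b i).map (algebraMap ℝ ℂ) - z • (1 : Matrix (Fin N) (Fin N) ℂ)).det = 0 →
          z.im = 0) →
      ∃ F : MvPolynomial (Fin 3) ℝ, F.IsHomogeneous N ∧ MvPolynomial.eval e F = 1 ∧
        (∀ w : Fin 3 → ℝ, Multiset.card (MvPolynomial.aeval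
          (fun i => Polynomial.C (w i) - Polynomial.C (e i) * Polynomial.X) F).roots = N) ∧
        ∀ v : Fin 3 → ℝ, MvPolynomial.eval v F = (∑ i, v i • b i).det := by
  intro N b e he hreal
  -- the pencil `Σ Xₖ bₖ` with entries in `ℝ[X₀,X₁,X₂]`, its determinant is the form `F`
  have hhom :=
    Literature.AlgebraicGeometry.DeterminantalHypersurfaces.isHomogeneous_det_sum_X_smul
      (R := ℝ) (ι := Fin 3) b
  have heval :=
    Literature.AlgebraicGeometry.DeterminantalHypersurfaces.eval_det_sum_X_smul
      (R := ℝ) (ι := Fin 3) b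
  rw [Fintype.card_fin] at hhom
  set P : Matrix (Fin N) (Fin N) (MvPolynomial (Fin 3) ℝ) :=
    ∑ k, (MvPolynomial.X k : MvPolynomial (Fin 3) ℝ) • (b k).map MvPolynomial.C with hP
  have hPij : ∀ i j, P i j = ∑ k, MvPolynomial.X k * MvPolynomial.C (b k i j) := by
    intro i j
    simp only [hP, Matrix.sum_apply, Matrix.smul_apply, Matrix.map_apply, smul_eq_mul]
  refine ⟨P.det, hhom, ?_, ?_, heval⟩
  · -- normalised at `e`: `F(e) = det (Σ eᵢ bᵢ) = det 1 = 1`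
    rw [heval, he, det_one]
  · -- hyperbolic w.r.t. `e`: `F(w - te) = (-1)^N det(t·1 - M)`, `M = Σ wᵢ bᵢ`
    intro w
    set g : Fin 3 → ℝ[X] := fun i => Polynomial.C (w i) - Polynomial.C (e i) * Polynomial.X
      with hg
    set M : Matrix (Fin N) (Fin N) ℝ := ∑ i, w i • b i with hM
    have hmat : (MvPolynomial.aeval g).toRingHom.mapMatrix P = -charmatrix M := by
      ext i j
      have hdiag : (Matrix.diagonal fun _ : Fin N => (X : ℝ[X])) i j =
          X * Polynomial.C ((∑ k, e k • b k) i j) := by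
        rw [he, Matrix.diagonal_apply, Matrix.one_apply]
        split_ifs <;> simp
      rw [RingHom.mapMatrix_apply, Matrix.map_apply, hPij, Matrix.neg_apply, charmatrix_apply,
        hdiag]
      simp only [hg, hM, Matrix.sum_apply, Matrix.add_apply, Matrix.smul_apply, smul_eq_mul,
        map_mul, map_add, Fin.sum_univ_three, AlgHom.toRingHom_eq_coe, RingHom.coe_coe,
        MvPolynomial.aeval_X, MvPolynomial.algHom_C, Polynomial.algebraMap_eq]
      ring
    have hdet : MvPolynomial.aeval g P.det = Polynomial.C ((-1 : ℝ) ^ N) * M.charpoly := by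
      rw [show MvPolynomial.aeval g P.det = (MvPolynomial.aeval g).toRingHom P.det from rfl,
        RingHom.map_det, hmat, det_neg, Fintype.card_fin, Matrix.charpoly, map_pow, map_neg,
        map_one]
    change Multiset.card (MvPolynomial.aeval g P.det).roots = N
    rw [hdet, roots_C_mul _ (pow_ne_zero _ (neg_ne_zero.mpr one_ne_zero)),
      splits_iff_card_roots.mp (permanentalCones_charpoly_splits_of_realSpectrum M (hreal w)),
      charpoly_natDegree_eq_dim, Fintype.card_fin]

end Summit.ValiantsHypothesis.ValiantsHypothesis.Theorems
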